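/-
Copyright (c) 2026 the pub-hodgecm-mathlib formalisation cell (harness21).  Prover seat hodgecm-mathlib-R90-C10-p08 (g3), R90-TF SLAB section S1 «Ch10-local» (base
R90-C10), h413 = `stmt-HodgeConjecture-24833`; line «U4Keys :182 — THE WILD CORNER (S-W-Rb)», brick (W-2d) «THE WILD GAUSS-SUM SQUARE MODULO THE INNER-VALUE LETTERS»
(scout `R90/R90-C10-p08/g3/SCOUT-PWILD1.v1.md` 03536fd8115e96cf item (4); sequel of ★ p865206 (W-2c) and ★ `R90S1BposRamGaussSquareModLetters` (R90-C10-p07 (g2))).  2026-09-05.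
-/
import Summits.HodgeConjecture.HodgeConjecture.Theorems.R90S1WildFixedUnitCharacterMasses   -- ★ p865206 (W-2c, this seat): the outer masses on the thresholds `T_j = {|(1+e)_w| ≤ |ϖ|^j}`; brings ★ (W-2) and the `hD` currency
import Summits.HodgeConjecture.HodgeConjecture.Theorems.R90S1BposRamGaussSquarePrep        -- ★ (G2)-prep A (R90-C10-p07 (g2)): THE SWAP `setIntegral_fixedUnits_gauss_sq_eq`, the sets `C, 𝔪⁺, 𝒪⁺`, the norm ∕ level bookkeeping of `E, Ē`; brings ★ `BposRamFixedUnitsHaar` (orthogonality)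
import HarnessLib

/-!
# R90-TF S1 «Ch10-local» ∕ U4Keys :182, THE WILD CORNER — brick (W-2d): the WILD Gauss-sum square on the fixed units, modulo the three inner-value letters:
# `(∫_C E(c)·Ē(1+uc) dν)² = χ₁(−1) · ν(T_{2d}) · (ν(𝔪⁺) + ν(C))`, `T_{2d} = {e ∈ R⁺ : |(1+e)_w| ≤ |ϖ|^{2d}}` — at `d = 1` this IS ★ `gauss_sq_eq`'s
# `χ₁(−1)·ν(𝔪⁺)·(ν(𝔪⁺) + ν(C))` (the classical `g² = ε(−1)q`), at a wild place it is `ω(−1)·q^{−d}·ν(𝒪⁺)²` (conductor `d` of `ω = χ₁|_{U_F}`)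

Cell `pub/hodgecm-mathlib`, crux H413 = `stmt-HodgeConjecture-24833`, route of record `HCCMUnconditional` (no route verbs); lane `--supports stmt-HodgeConjecture-24833 --as helper`,
count-neutral.  THEOREMS ONLY (no `def`, no `instance`, no `notation`, no named-fact hypothesis, no `sorry`); ★-only imports.  NOT THE PAYER of :182 ∕ (S-W-Rb): the
three inner-value letters `hI₂ hI₁ hI₀` and the additivity letter `hadd` are P-WILD-1's (the wild chart fixes `u` and the additive conductor of `c ↦ Ē(1 + u(1+e)c)`).

FRAME = ★ `R90S1BposRamGaussSquareModLetters` VERBATIM (`ν` regular additive Haar on `R⁺`, `χ₁` continuous (`h₁`), the skew parameter `u ∈ R` with `|u_w| < 1` (`hu`),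
`C = {c ∈ R⁺ : |c_w| = 1}`, `𝔪⁺ = {d ∈ R⁺ : |d_w| < 1}`, `E r = if IsUnit r then χ₁ r̂ else 0`, `Ē` its `χ₁⁻¹` twin, `G := ∫_C E(c)·Ē(1+uc) dν(c)`, `I(e) := ∫_C Ē(1 + u(1+e)c) dν(c)`),
with the tame letter `hfixP` (`χ₁ = 1` on the fixed PRINCIPAL units — the conductor-ONE statement, DEAD at a wild place) REPLACED by the place datum `hD : IsRamifiedQuadraticDatum σ_w ϖ d t`
+ `hFε` through ★ (W-2c) (conductor EXACTLY `d`), and the single tame threshold `T = −1 + 𝔪⁺` REPLACED by the two thresholds `T_{2(d−1)} ⊇ T_{2d}` (`T_j := {e ∈ R⁺ : |(1+e)_w| ≤ |ϖ|^j}`).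

WHAT IS PROVED (scout item (4), the `j = ord(1+e)`-SLICED square):
* §1 bookkeeping: `T_j` measurable; `C ∩ T_j = T_j` for `j ≥ 1`; `T_{2d} ⊆ T_{2(d−1)}`; the OUTER MASSES `∫_{C ∩ T_{2d}} E = χ₁(−1)·ν(T_{2d})` (★ (W-2c) (M1)) and
  `∫_{C ∩ T_{2(d−1)}} E = 0` (★ (W-2c) (M2) for `d ≥ 2`; at `d = 1`, `C ∩ T_0 = C` and ★ orthogonality `setIntegral_fixedUnits_dite_eq_zero_of_unit`), hence
  `∫_{(C ∩ T_{2(d−1)}) ∖ T_{2d}} E = −χ₁(−1)·ν(T_{2d})`.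
* §2 **`gauss_sq_eq_wild`**: with the swap (★ `setIntegral_fixedUnits_gauss_sq_eq`, letters `hB hadd`) and the inner values `I(e) = 0` off `T_{2(d−1)}` (`hI₂`), `= −ν(𝔪⁺)` on
  `T_{2(d−1)} ∖ T_{2d}` (`hI₁`), `= ν(C)` on `T_{2d}` (`hI₀`): **`G² = χ₁(−1)·ν(T_{2d})·(ν(𝔪⁺) + ν(C))`**.  At `d = 1` the letters `hI₂`∕`hI₁`∕`hI₀` are (vacuous)∕★'s `hI₁`∕★'s `hI₀`
  (fixed elements have even order, so `¬ |1+e| ≤ |ϖ|²` iff `|1+e| = 1`), and `ν(T_2) = ν(𝔪⁺)`: the tame ★ `gauss_sq_eq` is recovered WITHOUT `hfixP`.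
HONEST LABEL.  HC_CM is proved only modulo the 7 printed citations (2 remaining named inputs: hLiu418 = `stmt-HodgeConjecture-24832`, h413 = `stmt-HodgeConjecture-24833`) until rung 0
closes; (W-2d) is infrastructure of the (S-W-Rb) wild determinant road (P-WILD-1 delivers `hadd hI₂ hI₁ hI₀` and the chart) and pays NO socket; (S-W) stays OPEN; REL ≠ ★ ≠ BUILT.

## References
* [IrelandRosen1990] K. Ireland, M. Rosen, *A Classical Introduction to Modern Number Theory*, 2nd ed., GTM 84 (1990), Ch. 8 §2 Prop. 8.2.2 (`g² = χ(−1)p`).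
* [BushnellHenniart2006] C. J. Bushnell, G. Henniart, *The Local Langlands Conjecture for GL(2)*, Grundlehren 335 (2006), §23 (Gauss sums and `ε(χ,ψ)ε(χ̄,ψ) = χ(−1)`).
* [Serre1979] J.-P. Serre, *Local Fields*, GTM 67 (1979), Ch. V §3 Prop. 5 Cor. 2–3 pp. 84–86, Ch. XV §2 (conductor of the norm residue symbol).
* [Keys1984] D. Keys, *Principal series representations of special unitary groups over local fields*, Compositio Math. 51 (1984), §4–§5, §7 Theorem (2) (d) p. 126.
* [WeilBNT1967] A. Weil, *Basic Number Theory* (1967), Ch. I §2, Ch. II §5.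
-/

set_option autoImplicit false
-- the mandated namespace has the single-problem summit's repeated segment (`HodgeConjecture.HodgeConjecture`)
set_option linter.dupNamespace false

noncomputable section

open NumberField IsDedekindDomain MeasureTheory Measure Topology Set
open scoped NNReal ENNReal Valued
open Literature.NumberTheory Literature.NumberTheory.Automorphic Literature.NumberTheory.Automorphic.UnitaryGroup
open Literature.NumberTheory.Automorphic.UnitaryThreeFourFrame (IsRamifiedQuadraticDatum)
open Literature.NumberTheory.LocalFields

namespace Summit.HodgeConjecture.HodgeConjecture.R90.S1.WildGaussSquareModLetters

open Summit.HodgeConjecture.HodgeConjecture.Cruxes.H413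
open Summit.HodgeConjecture.HodgeConjecture.Cruxes.H413.K2E3BranchBSkewLineIntegrals
open Summit.HodgeConjecture.HodgeConjecture.Cruxes.H413.K2E3BranchBSkewLineCharacterIntegral
open Summit.HodgeConjecture.HodgeConjecture.Cruxes.H413.K2E3BranchBSkewUnitSign
open Summit.HodgeConjecture.HodgeConjecture.R90.S1.BposRamFixedUnitsHaar
open Summit.HodgeConjecture.HodgeConjecture.R90.S1.BposRamGaussSquarePrep
open Summit.HodgeConjecture.HodgeConjecture.R90.S1.WildFixedUnitCharacterMasses

variable (L : Type) [Field L] [NumberField L] [IsCMField L] (v : HeightOneSpectrum (𝓞 ↥(maximalRealSubfield L)))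
  (w : PlacesOver L v) (hw : IsCMField.complexConj L • w.1 = w.1)

/-! ## §1 The thresholds `T_j = {e ∈ R⁺ : |(1+e)_w| ≤ |ϖ|^j}`: measurability, `C ∩ T_j`, nesting, outer masses -/

/-- **`T_j` is measurable** (clopen: preimage of the closed ball `{|z| ≤ |ϖ^j|}` of `L_w` under the continuous `e ↦ (1 + e)_w`). [cite: WeilBNT1967, Ch. I §2] -/
theorem measurableSet_threshold [MeasurableSpace (LocalRing L v)] [BorelSpace (LocalRing L v)] {ϖ : w.1.adicCompletion L} (hϖ : Valued.v ϖ = WithZero.exp (-1 : ℤ)) (j : ℕ) :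
    MeasurableSet {e : ↥(HeisRing.fixedPart (conjLocal L (IsCMField.complexConj L) v)) | Valued.v ((1 + (e : LocalRing L v)) w) ≤ Valued.v ϖ ^ j} := by
  have hϖ0 : ϖ ≠ 0 := fun h0 => by rw [h0, map_zero] at hϖ; exact WithZero.zero_ne_coe hϖ
  have h : {e : ↥(HeisRing.fixedPart (conjLocal L (IsCMField.complexConj L) v)) | Valued.v ((1 + (e : LocalRing L v)) w) ≤ Valued.v ϖ ^ j} =
      (fun e : ↥(HeisRing.fixedPart (conjLocal L (IsCMField.complexConj L) v)) => (1 + (e : LocalRing L v)) w) ⁻¹'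
        {z : w.1.adicCompletion L | Valued.v z ≤ Valued.v (ϖ ^ j)} := by
    ext e; rw [Set.mem_preimage, Set.mem_setOf_eq, Set.mem_setOf_eq, map_pow]
  rw [h]
  exact ((isClopen_setOf_valued_le_valued L v w (pow_ne_zero j hϖ0)).preimage
    ((continuous_apply w).comp (continuous_const.add continuous_subtype_val))).isClosed.measurableSet

/-- **`C ∩ T_j = T_j` for `j ≥ 1`**: `|(1 + e)_w| ≤ |ϖ|^j < 1` forces `|e_w| = 1`. [cite: WeilBNT1967, Ch. I §2] -/
theorem fixedUnits_inter_threshold_eq {ϖ : w.1.adicCompletion L} (hϖ : Valued.v ϖ = WithZero.exp (-1 : ℤ)) {j : ℕ} (hj : 1 ≤ j) :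
    {c : ↥(HeisRing.fixedPart (conjLocal L (IsCMField.complexConj L) v)) | Valued.v ((c : LocalRing L v) w) = 1} ∩
        {e : ↥(HeisRing.fixedPart (conjLocal L (IsCMField.complexConj L) v)) | Valued.v ((1 + (e : LocalRing L v)) w) ≤ Valued.v ϖ ^ j} =
      {e : ↥(HeisRing.fixedPart (conjLocal L (IsCMField.complexConj L) v)) | Valued.v ((1 + (e : LocalRing L v)) w) ≤ Valued.v ϖ ^ j} := by
  have hlt : Valued.v ϖ ^ j < 1 := by
    rw [WildQuadraticDatum.v_varpi_pow hϖ j, ← WithZero.exp_zero, WithZero.exp_lt_exp]; omega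
  refine Set.inter_eq_right.2 fun e (he : Valued.v ((1 + (e : LocalRing L v)) w) ≤ Valued.v ϖ ^ j) => ?_
  show Valued.v ((e : LocalRing L v) w) = 1
  have h : (e : LocalRing L v) w = -1 + (1 + (e : LocalRing L v)) w := by rw [Pi.add_apply, Pi.one_apply]; ring
  rw [h, Valuation.map_add_eq_of_lt_left _ (by rw [Valuation.map_neg, map_one]; exact lt_of_le_of_lt he hlt), Valuation.map_neg, map_one]

/-- **`T_{2d} ⊆ T_{2(d−1)}`** (`|ϖ|^{2d} ≤ |ϖ|^{2(d−1)}`). [cite: Serre1979, Ch. II §1] -/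
theorem threshold_subset_threshold {ϖ : w.1.adicCompletion L} (hϖ : Valued.v ϖ = WithZero.exp (-1 : ℤ)) {a b : ℕ} (h : b ≤ a) :
    {e : ↥(HeisRing.fixedPart (conjLocal L (IsCMField.complexConj L) v)) | Valued.v ((1 + (e : LocalRing L v)) w) ≤ Valued.v ϖ ^ a} ⊆
      {e : ↥(HeisRing.fixedPart (conjLocal L (IsCMField.complexConj L) v)) | Valued.v ((1 + (e : LocalRing L v)) w) ≤ Valued.v ϖ ^ b} := by
  intro e he
  refine le_trans (show Valued.v ((1 + (e : LocalRing L v)) w) ≤ Valued.v ϖ ^ a from he) ?_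
  rw [WildQuadraticDatum.v_varpi_pow hϖ a, WildQuadraticDatum.v_varpi_pow hϖ b, WithZero.exp_le_exp]; omega

section Haar

variable [MeasurableSpace (LocalRing L v)] [BorelSpace (LocalRing L v)]
  (ν : Measure ↥(HeisRing.fixedPart (conjLocal L (IsCMField.complexConj L) v))) [ν.IsAddHaarMeasure] [ν.Regular]
  (χ₁ : (LocalRing L v)ˣ →* ℂˣ) (h₁ : Continuous fun x => ((χ₁ x : ℂˣ) : ℂ)) {u : LocalRing L v} (hu : Valued.v (u w) < 1)

open scoped Classical in
omit [ν.IsAddHaarMeasure] [ν.Regular] in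
include hw in
/-- **DEEP OUTER MASS: `∫_{C ∩ T_{2d}} E dν = χ₁(−1)·ν(T_{2d})`** (`C ∩ T_{2d} = T_{2d}`; ★ (W-2c) (M1) at `j = 2d ≥ 2d − 1`). [cite: Serre1979, Ch. XV §2] [cite: Keys1984, §4–§5] -/
theorem setIntegral_fixedUnits_inter_deepThreshold_dite_eq
    (hB : ∀ u : (LocalRing L v)ˣ, (∀ w' : PlacesOver L v, Valued.v ((u : LocalRing L v) w') = 1) →
      χ₁ (u * Units.map (conjLocal L (IsCMField.complexConj L) v : LocalRing L v →* LocalRing L v) u) = 1)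
    {ϖ : w.1.adicCompletion L} {d t : ℕ} (hD : IsRamifiedQuadraticDatum (galAdicCompletionMap (L := L) (IsCMField.complexConj L) hw) ϖ d t) :
    ∫ e in {c : ↥(HeisRing.fixedPart (conjLocal L (IsCMField.complexConj L) v)) | Valued.v ((c : LocalRing L v) w) = 1} ∩
        {e : ↥(HeisRing.fixedPart (conjLocal L (IsCMField.complexConj L) v)) | Valued.v ((1 + (e : LocalRing L v)) w) ≤ Valued.v ϖ ^ (2 * d)},
        (fun r : LocalRing L v => if h : IsUnit r then ((χ₁ h.unit : ℂˣ) : ℂ) else 0) (e : LocalRing L v) ∂ν =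
      ((χ₁ (-1) : ℂˣ) : ℂ) * ((ν.real {e : ↥(HeisRing.fixedPart (conjLocal L (IsCMField.complexConj L) v)) | Valued.v ((1 + (e : LocalRing L v)) w) ≤ Valued.v ϖ ^ (2 * d)} : ℝ) : ℂ) := by
  have hd1 : 1 ≤ d := hD.2.2.2.2.2.1
  rw [fixedUnits_inter_threshold_eq L v w hD.2.2.1 (show 1 ≤ 2 * d by omega),
    setIntegral_near_neg_one_dite_eq_of_le L v w hw ν χ₁ hB hD (show 2 * d - 1 ≤ 2 * d by omega), mul_comm]

open scoped Classical in
include hw in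
/-- **SHALLOW OUTER MASS: `∫_{C ∩ T_{2(d−1)}} E dν = 0`** — for `d ≥ 2`, `C ∩ T_{2(d−1)} = T_{2(d−1)}` and ★ (W-2c) (M2); for `d = 1`, `T_0 ⊇ C` and ★ ORTHOGONALITY
`setIntegral_fixedUnits_dite_eq_zero_of_unit` with the (R-b) witness of `hFε`. [cite: Serre1979, Ch. XV §2] [cite: WeilBNT1967, Ch. II §5] [cite: Keys1984, §7 Theorem (2) (d) p. 126] -/
theorem setIntegral_fixedUnits_inter_shallowThreshold_dite_eq_zero
    (hB : ∀ u : (LocalRing L v)ˣ, (∀ w' : PlacesOver L v, Valued.v ((u : LocalRing L v) w') = 1) →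
      χ₁ (u * Units.map (conjLocal L (IsCMField.complexConj L) v : LocalRing L v →* LocalRing L v) u) = 1)
    (hFε : ∃ a : (LocalRing L v)ˣ, Units.map (conjLocal L (IsCMField.complexConj L) v : LocalRing L v →* LocalRing L v) a = a ∧
      (∀ w' : PlacesOver L v, Valued.v ((a : LocalRing L v) w') = 1) ∧ χ₁ a ≠ 1)
    {ϖ : w.1.adicCompletion L} {d t : ℕ} (hD : IsRamifiedQuadraticDatum (galAdicCompletionMap (L := L) (IsCMField.complexConj L) hw) ϖ d t) :
    ∫ e in {c : ↥(HeisRing.fixedPart (conjLocal L (IsCMField.complexConj L) v)) | Valued.v ((c : LocalRing L v) w) = 1} ∩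
        {e : ↥(HeisRing.fixedPart (conjLocal L (IsCMField.complexConj L) v)) | Valued.v ((1 + (e : LocalRing L v)) w) ≤ Valued.v ϖ ^ (2 * (d - 1))},
        (fun r : LocalRing L v => if h : IsUnit r then ((χ₁ h.unit : ℂˣ) : ℂ) else 0) (e : LocalRing L v) ∂ν = 0 := by
  have hd1 : 1 ≤ d := hD.2.2.2.2.2.1
  rcases Nat.lt_or_ge 1 d with hd2 | hdle
  · -- `d ≥ 2`: the threshold lies inside `C`
    rw [fixedUnits_inter_threshold_eq L v w hD.2.2.1 (show 1 ≤ 2 * (d - 1) by omega)]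
    exact setIntegral_near_neg_one_dite_eq_zero_of_le L v w hw ν χ₁ hB hFε hD le_rfl
  · -- `d = 1`: `T_0 ⊇ C`, orthogonality on all of `C`
    have hd : d = 1 := le_antisymm hdle hd1
    have hCT : {c : ↥(HeisRing.fixedPart (conjLocal L (IsCMField.complexConj L) v)) | Valued.v ((c : LocalRing L v) w) = 1} ∩
        {e : ↥(HeisRing.fixedPart (conjLocal L (IsCMField.complexConj L) v)) | Valued.v ((1 + (e : LocalRing L v)) w) ≤ Valued.v ϖ ^ (2 * (d - 1))} =
        {c : ↥(HeisRing.fixedPart (conjLocal L (IsCMField.complexConj L) v)) | Valued.v ((c : LocalRing L v) w) = 1} := by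
      refine Set.inter_eq_left.2 fun e (he : Valued.v ((e : LocalRing L v) w) = 1) => ?_
      show Valued.v ((1 + (e : LocalRing L v)) w) ≤ Valued.v ϖ ^ (2 * (d - 1))
      rw [hd]; simpa using valued_one_add_apply_le_one L v w he
    rw [hCT]
    obtain ⟨a₀, ha₀σ, ha₀v, hχa₀⟩ := hFε
    have ha₀σ' : conjLocal L (IsCMField.complexConj L) v (a₀ : LocalRing L v) = a₀ := by
      have h := congrArg (fun x : (LocalRing L v)ˣ => (x : LocalRing L v)) ha₀σ
      simpa only [Units.coe_map, MonoidHom.coe_coe] using h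
    exact setIntegral_fixedUnits_dite_eq_zero_of_unit L v w hw ν χ₁ a₀ ha₀σ' (ha₀v w) hχa₀

open scoped Classical in
include hw h₁ in
/-- **THE MIDDLE SLICE: `∫_{(C ∩ T_{2(d−1)}) ∖ T_{2d}} E dν = −χ₁(−1)·ν(T_{2d})`** (shallow mass `0` minus deep mass; `E` is bounded by `1` on `C`, a set of finite measure).
[cite: Serre1979, Ch. XV §2] [cite: WeilBNT1967, Ch. II §5] -/
theorem setIntegral_fixedUnits_middleSlice_dite_eq
    (hB : ∀ u : (LocalRing L v)ˣ, (∀ w' : PlacesOver L v, Valued.v ((u : LocalRing L v) w') = 1) →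
      χ₁ (u * Units.map (conjLocal L (IsCMField.complexConj L) v : LocalRing L v →* LocalRing L v) u) = 1)
    (hFε : ∃ a : (LocalRing L v)ˣ, Units.map (conjLocal L (IsCMField.complexConj L) v : LocalRing L v →* LocalRing L v) a = a ∧
      (∀ w' : PlacesOver L v, Valued.v ((a : LocalRing L v) w') = 1) ∧ χ₁ a ≠ 1)
    {ϖ : w.1.adicCompletion L} {d t : ℕ} (hD : IsRamifiedQuadraticDatum (galAdicCompletionMap (L := L) (IsCMField.complexConj L) hw) ϖ d t) :
    ∫ e in ({c : ↥(HeisRing.fixedPart (conjLocal L (IsCMField.complexConj L) v)) | Valued.v ((c : LocalRing L v) w) = 1} ∩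
          {e : ↥(HeisRing.fixedPart (conjLocal L (IsCMField.complexConj L) v)) | Valued.v ((1 + (e : LocalRing L v)) w) ≤ Valued.v ϖ ^ (2 * (d - 1))}) \
        {e : ↥(HeisRing.fixedPart (conjLocal L (IsCMField.complexConj L) v)) | Valued.v ((1 + (e : LocalRing L v)) w) ≤ Valued.v ϖ ^ (2 * d)},
        (fun r : LocalRing L v => if h : IsUnit r then ((χ₁ h.unit : ℂˣ) : ℂ) else 0) (e : LocalRing L v) ∂ν =
      -(((χ₁ (-1) : ℂˣ) : ℂ) * ((ν.real {e : ↥(HeisRing.fixedPart (conjLocal L (IsCMField.complexConj L) v)) | Valued.v ((1 + (e : LocalRing L v)) w) ≤ Valued.v ϖ ^ (2 * d)} : ℝ) : ℂ)) := by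
  have hϖ : Valued.v ϖ = WithZero.exp (-1 : ℤ) := hD.2.2.1
  have hCm : MeasurableSet {c : ↥(HeisRing.fixedPart (conjLocal L (IsCMField.complexConj L) v)) | Valued.v ((c : LocalRing L v) w) = 1} :=
    (measurableSet_fixedUnits L v w).1
  have hT1m := measurableSet_threshold L v w hϖ (2 * (d - 1))
  have hT0m := measurableSet_threshold L v w hϖ (2 * d)
  obtain ⟨-, hCtop⟩ := measure_fixedUnits_pos_lt_top L v w hw ν
  -- `E` is integrable on `C ∩ T_{2(d−1)}` (bounded by `1`, finite measure)
  have hint : IntegrableOn (fun e : ↥(HeisRing.fixedPart (conjLocal L (IsCMField.complexConj L) v)) =>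
      (fun r : LocalRing L v => if h : IsUnit r then ((χ₁ h.unit : ℂˣ) : ℂ) else 0) (e : LocalRing L v))
      ({c : ↥(HeisRing.fixedPart (conjLocal L (IsCMField.complexConj L) v)) | Valued.v ((c : LocalRing L v) w) = 1} ∩
        {e : ↥(HeisRing.fixedPart (conjLocal L (IsCMField.complexConj L) v)) | Valued.v ((1 + (e : LocalRing L v)) w) ≤ Valued.v ϖ ^ (2 * (d - 1))}) ν :=
    Measure.integrableOn_of_bounded (lt_of_le_of_lt (measure_mono Set.inter_subset_left) hCtop).ne
      ((measurable_dite_isUnit L v w hw (fun x => ((χ₁ x : ℂˣ) : ℂ)) h₁).comp measurable_subtype_coe).aestronglyMeasurable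
      ((ae_restrict_mem (hCm.inter hT1m)).mono fun e he => norm_dite_apply_le_one L v w hw χ₁ h₁ _ he.1)
  have hsplit := integral_inter_add_sdiff hT0m hint
  -- `(C ∩ T_{2(d−1)}) ∩ T_{2d} = C ∩ T_{2d}`
  have hset : {c : ↥(HeisRing.fixedPart (conjLocal L (IsCMField.complexConj L) v)) | Valued.v ((c : LocalRing L v) w) = 1} ∩
        {e : ↥(HeisRing.fixedPart (conjLocal L (IsCMField.complexConj L) v)) | Valued.v ((1 + (e : LocalRing L v)) w) ≤ Valued.v ϖ ^ (2 * (d - 1))} ∩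
        {e : ↥(HeisRing.fixedPart (conjLocal L (IsCMField.complexConj L) v)) | Valued.v ((1 + (e : LocalRing L v)) w) ≤ Valued.v ϖ ^ (2 * d)} =
      {c : ↥(HeisRing.fixedPart (conjLocal L (IsCMField.complexConj L) v)) | Valued.v ((c : LocalRing L v) w) = 1} ∩
        {e : ↥(HeisRing.fixedPart (conjLocal L (IsCMField.complexConj L) v)) | Valued.v ((1 + (e : LocalRing L v)) w) ≤ Valued.v ϖ ^ (2 * d)} := by
    rw [Set.inter_assoc, Set.inter_eq_right.2 (threshold_subset_threshold L v w hϖ (show 2 * (d - 1) ≤ 2 * d by omega))]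
  rw [hset, setIntegral_fixedUnits_inter_deepThreshold_dite_eq L v w hw ν χ₁ hB hD,
    setIntegral_fixedUnits_inter_shallowThreshold_dite_eq_zero L v w hw ν χ₁ hB hFε hD] at hsplit
  linear_combination hsplit

/-! ## §2 THE WILD GAUSS-SUM SQUARE modulo the three inner-value letters -/

open scoped Classical in
include hw h₁ hu in
/-- **`(∫_C E(c)·Ē(1+uc) dν)² = χ₁(−1)·ν(T_{2d})·(ν(𝔪⁺) + ν(C))`** given the SWAP letters `hB hadd` (★ `setIntegral_fixedUnits_gauss_sq_eq`) and the inner values `I(e) := ∫_C Ē(1 + u(1+e)c) dν(c)`: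
`= 0` for `e ∈ C` off `T_{2(d−1)}` (`hI₂`, additive conductor `≥ 2`), `= −ν(𝔪⁺)` on `T_{2(d−1)} ∖ T_{2d}` (`hI₁`, conductor `1`), `= ν(C)` on `T_{2d}` (`hI₀`, conductor `0`), and the OUTER masses of
★ (W-2c) (conductor of `χ₁|_{U_F}` EXACTLY `d`: `hD`, `hFε`): the `j = ord(1+e)`-sliced T-split of ★ `gauss_sq_eq` — slices `j < d − 1` carry no inner value, slice `j = d − 1` pairs
`−ν(𝔪⁺)` with `−χ₁(−1)ν(T_{2d})`, the tail `j ≥ d` pairs `ν(C)` with `χ₁(−1)ν(T_{2d})`.  (Classically `G(ω,ψ)² = ω(−1)·q^{a(ω)}` for a quadratic `ω` of conductor `a(ω)`.)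
[cite: IrelandRosen1990, Ch. 8 §2 Prop. 8.2.2] [cite: BushnellHenniart2006, §23] [cite: Keys1984, §4–§5, §7 Theorem (2) (d)] [cite: WeilBNT1967, Ch. II §5] -/
theorem gauss_sq_eq_wild
    (hB : ∀ u : (LocalRing L v)ˣ, (∀ w' : PlacesOver L v, Valued.v ((u : LocalRing L v) w') = 1) →
      χ₁ (u * Units.map (conjLocal L (IsCMField.complexConj L) v : LocalRing L v →* LocalRing L v) u) = 1)
    (hFε : ∃ a : (LocalRing L v)ˣ, Units.map (conjLocal L (IsCMField.complexConj L) v : LocalRing L v →* LocalRing L v) a = a ∧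
      (∀ w' : PlacesOver L v, Valued.v ((a : LocalRing L v) w') = 1) ∧ χ₁ a ≠ 1)
    {ϖ : w.1.adicCompletion L} {d t : ℕ} (hD : IsRamifiedQuadraticDatum (galAdicCompletionMap (L := L) (IsCMField.complexConj L) hw) ϖ d t)
    (hadd : ∀ c e : LocalRing L v, conjLocal L (IsCMField.complexConj L) v c = c → Valued.v (c w) = 1 →
      conjLocal L (IsCMField.complexConj L) v e = e → Valued.v (e w) = 1 →
      (fun r : LocalRing L v => if h : IsUnit r then (((χ₁ h.unit)⁻¹ : ℂˣ) : ℂ) else 0) (1 + u * c) *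
          (fun r : LocalRing L v => if h : IsUnit r then (((χ₁ h.unit)⁻¹ : ℂˣ) : ℂ) else 0) (1 + u * (c * e)) =
        (fun r : LocalRing L v => if h : IsUnit r then (((χ₁ h.unit)⁻¹ : ℂˣ) : ℂ) else 0) (1 + u * (1 + e) * c))
    (hI₂ : ∀ e : LocalRing L v, conjLocal L (IsCMField.complexConj L) v e = e → Valued.v (e w) = 1 → ¬ Valued.v ((1 + e) w) ≤ Valued.v ϖ ^ (2 * (d - 1)) →
      ∫ c in {c : ↥(HeisRing.fixedPart (conjLocal L (IsCMField.complexConj L) v)) | Valued.v ((c : LocalRing L v) w) = 1},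
          (fun r : LocalRing L v => if h : IsUnit r then (((χ₁ h.unit)⁻¹ : ℂˣ) : ℂ) else 0) (1 + u * (1 + e) * (c : LocalRing L v)) ∂ν = 0)
    (hI₁ : ∀ e : LocalRing L v, conjLocal L (IsCMField.complexConj L) v e = e → Valued.v (e w) = 1 → Valued.v ((1 + e) w) ≤ Valued.v ϖ ^ (2 * (d - 1)) →
      ¬ Valued.v ((1 + e) w) ≤ Valued.v ϖ ^ (2 * d) →
      ∫ c in {c : ↥(HeisRing.fixedPart (conjLocal L (IsCMField.complexConj L) v)) | Valued.v ((c : LocalRing L v) w) = 1},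
          (fun r : LocalRing L v => if h : IsUnit r then (((χ₁ h.unit)⁻¹ : ℂˣ) : ℂ) else 0) (1 + u * (1 + e) * (c : LocalRing L v)) ∂ν =
        -((ν.real {d : ↥(HeisRing.fixedPart (conjLocal L (IsCMField.complexConj L) v)) | Valued.v ((d : LocalRing L v) w) < 1} : ℝ) : ℂ))
    (hI₀ : ∀ e : LocalRing L v, conjLocal L (IsCMField.complexConj L) v e = e → Valued.v (e w) = 1 → Valued.v ((1 + e) w) ≤ Valued.v ϖ ^ (2 * d) →
      ∫ c in {c : ↥(HeisRing.fixedPart (conjLocal L (IsCMField.complexConj L) v)) | Valued.v ((c : LocalRing L v) w) = 1},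
          (fun r : LocalRing L v => if h : IsUnit r then (((χ₁ h.unit)⁻¹ : ℂˣ) : ℂ) else 0) (1 + u * (1 + e) * (c : LocalRing L v)) ∂ν =
        ((ν.real {c : ↥(HeisRing.fixedPart (conjLocal L (IsCMField.complexConj L) v)) | Valued.v ((c : LocalRing L v) w) = 1} : ℝ) : ℂ)) :
    (∫ c in {c : ↥(HeisRing.fixedPart (conjLocal L (IsCMField.complexConj L) v)) | Valued.v ((c : LocalRing L v) w) = 1},
        (fun r : LocalRing L v => if h : IsUnit r then ((χ₁ h.unit : ℂˣ) : ℂ) else 0) (c : LocalRing L v) *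
          (fun r : LocalRing L v => if h : IsUnit r then (((χ₁ h.unit)⁻¹ : ℂˣ) : ℂ) else 0) (1 + u * (c : LocalRing L v)) ∂ν) ^ 2 =
      ((χ₁ (-1) : ℂˣ) : ℂ) * ((ν.real {e : ↥(HeisRing.fixedPart (conjLocal L (IsCMField.complexConj L) v)) | Valued.v ((1 + (e : LocalRing L v)) w) ≤ Valued.v ϖ ^ (2 * d)} : ℝ) : ℂ) *
        (((ν.real {d : ↥(HeisRing.fixedPart (conjLocal L (IsCMField.complexConj L) v)) | Valued.v ((d : LocalRing L v) w) < 1} : ℝ) : ℂ) +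
          ((ν.real {c : ↥(HeisRing.fixedPart (conjLocal L (IsCMField.complexConj L) v)) | Valued.v ((c : LocalRing L v) w) = 1} : ℝ) : ℂ)) := by
  haveI : SecondCountableTopology (LocalRing L v) := secondCountableTopology_localRing (E := L) v
  haveI : SecondCountableTopology ↥(HeisRing.fixedPart (conjLocal L (IsCMField.complexConj L) v)) := TopologicalSpace.Subtype.secondCountableTopology _
  haveI := HeisRing.locallyCompactSpace_fixedPart (conjLocal L (IsCMField.complexConj L) v) (continuous_conjLocal L (IsCMField.complexConj L) v)
  have hϖ : Valued.v ϖ = WithZero.exp (-1 : ℤ) := hD.2.2.1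
  set C : Set ↥(HeisRing.fixedPart (conjLocal L (IsCMField.complexConj L) v)) := {c | Valued.v ((c : LocalRing L v) w) = 1} with hCdef
  set T1 : Set ↥(HeisRing.fixedPart (conjLocal L (IsCMField.complexConj L) v)) := {e | Valued.v ((1 + (e : LocalRing L v)) w) ≤ Valued.v ϖ ^ (2 * (d - 1))} with hT1def
  set T0 : Set ↥(HeisRing.fixedPart (conjLocal L (IsCMField.complexConj L) v)) := {e | Valued.v ((1 + (e : LocalRing L v)) w) ≤ Valued.v ϖ ^ (2 * d)} with hT0def
  set I : ↥(HeisRing.fixedPart (conjLocal L (IsCMField.complexConj L) v)) → ℂ := fun e =>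
    ∫ c in C, (fun r : LocalRing L v => if h : IsUnit r then (((χ₁ h.unit)⁻¹ : ℂˣ) : ℂ) else 0) (1 + u * (1 + (e : LocalRing L v)) * (c : LocalRing L v)) ∂ν with hIdef
  have hfix : ∀ c : ↥(HeisRing.fixedPart (conjLocal L (IsCMField.complexConj L) v)), conjLocal L (IsCMField.complexConj L) v (c : LocalRing L v) = c :=
    fun c => (HeisRing.mem_fixedPart_iff _ _).1 c.2
  have hCm : MeasurableSet C := (measurableSet_fixedUnits L v w).1
  have hT1m : MeasurableSet T1 := measurableSet_threshold L v w hϖ (2 * (d - 1))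
  have hT0m : MeasurableSet T0 := measurableSet_threshold L v w hϖ (2 * d)
  obtain ⟨-, hCtop⟩ := measure_fixedUnits_pos_lt_top L v w hw ν
  haveI : IsFiniteMeasure (ν.restrict C) := ⟨by rw [Measure.restrict_apply_univ]; exact hCtop⟩
  rw [setIntegral_fixedUnits_gauss_sq_eq L v w hw ν χ₁ h₁ hu hB hadd]
  -- `|I(e)| ≤ ν(C)` on `C`, so `e ↦ E(e)·I(e)` is integrable on `C` (verbatim ★ `gauss_sq_eq`)
  have hIb : ∀ e ∈ C, ‖I e‖ ≤ 1 * ν.real C := fun e he => by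
    rw [hIdef]
    refine norm_setIntegral_le_of_norm_le_const hCtop fun c hc => ?_
    beta_reduce
    refine norm_diteInv_apply_le_one L v w hw χ₁ h₁ _ ?_
    rw [mul_assoc]
    refine valued_one_add_mul_apply_eq_one L v w hu ?_
    rw [Pi.mul_apply, map_mul]
    exact mul_le_one' (valued_one_add_apply_le_one L v w he) hc.le
  have hEbm : Measurable (fun r : LocalRing L v => if h : IsUnit r then (((χ₁ h.unit)⁻¹ : ℂˣ) : ℂ) else 0) :=
    measurable_dite_isUnit L v w hw (fun x => (((χ₁ x)⁻¹ : ℂˣ) : ℂ)) (continuous_chiInv L v χ₁ h₁)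
  have hFm : Measurable (Function.uncurry fun (e c : ↥(HeisRing.fixedPart (conjLocal L (IsCMField.complexConj L) v))) =>
      (fun r : LocalRing L v => if h : IsUnit r then (((χ₁ h.unit)⁻¹ : ℂˣ) : ℂ) else 0) (1 + u * (1 + (e : LocalRing L v)) * (c : LocalRing L v))) :=
    hEbm.comp (continuous_const.add ((continuous_const.mul (continuous_const.add (continuous_subtype_val.comp continuous_fst))).mul
      (continuous_subtype_val.comp continuous_snd))).measurable
  have hIm : AEStronglyMeasurable (fun e : ↥(HeisRing.fixedPart (conjLocal L (IsCMField.complexConj L) v)) => (fun r : LocalRing L v => if h : IsUnit r then ((χ₁ h.unit : ℂˣ) : ℂ) else 0) (e : LocalRing L v) * I e) ν :=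
    (((measurable_dite_isUnit L v w hw (fun x => ((χ₁ x : ℂˣ) : ℂ)) h₁).comp measurable_subtype_coe).aestronglyMeasurable).mul
      (hFm.stronglyMeasurable.integral_prod_right (ν := ν.restrict C)).aestronglyMeasurable
  have hint : IntegrableOn (fun e : ↥(HeisRing.fixedPart (conjLocal L (IsCMField.complexConj L) v)) => (fun r : LocalRing L v => if h : IsUnit r then ((χ₁ h.unit : ℂˣ) : ℂ) else 0) (e : LocalRing L v) * I e) C ν :=
    Measure.integrableOn_of_bounded hCtop.ne hIm ((ae_restrict_mem hCm).mono fun e he => by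
      rw [norm_mul]; exact mul_le_mul (norm_dite_apply_le_one L v w hw χ₁ h₁ _ he) (hIb e he) (norm_nonneg _) zero_le_one)
  -- first split along `T_{2(d−1)}`, then the inner piece along `T_{2d}`
  rw [← integral_inter_add_sdiff hT1m hint, ← integral_inter_add_sdiff hT0m (hint.mono_set Set.inter_subset_left)]
  have hset : C ∩ T1 ∩ T0 = C ∩ T0 := by
    rw [Set.inter_assoc, Set.inter_eq_right.2 (threshold_subset_threshold L v w hϖ (show 2 * (d - 1) ≤ 2 * d by omega))]
  -- piece `C ∩ T_{2d}`: `I = ν(C)`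
  have h0 : ∫ e in C ∩ T1 ∩ T0, (fun r : LocalRing L v => if h : IsUnit r then ((χ₁ h.unit : ℂˣ) : ℂ) else 0) (e : LocalRing L v) * I e ∂ν =
      (∫ e in C ∩ T0, (fun r : LocalRing L v => if h : IsUnit r then ((χ₁ h.unit : ℂˣ) : ℂ) else 0) (e : LocalRing L v) ∂ν) * ((ν.real C : ℝ) : ℂ) := by
    rw [hset, ← integral_mul_const]
    refine setIntegral_congr_fun (hCm.inter hT0m) fun e he => ?_
    show (fun r : LocalRing L v => if h : IsUnit r then ((χ₁ h.unit : ℂˣ) : ℂ) else 0) (e : LocalRing L v) * I e = (fun r : LocalRing L v => if h : IsUnit r then ((χ₁ h.unit : ℂˣ) : ℂ) else 0) (e : LocalRing L v) * ((ν.real C : ℝ) : ℂ)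
    rw [hIdef]; beta_reduce
    have h := hI₀ _ (hfix e) he.1 he.2
    beta_reduce at h
    rw [h]
  -- piece `(C ∩ T_{2(d−1)}) ∖ T_{2d}`: `I = −ν(𝔪⁺)`
  have h1 : ∫ e in (C ∩ T1) \ T0, (fun r : LocalRing L v => if h : IsUnit r then ((χ₁ h.unit : ℂˣ) : ℂ) else 0) (e : LocalRing L v) * I e ∂ν =
      (∫ e in (C ∩ T1) \ T0, (fun r : LocalRing L v => if h : IsUnit r then ((χ₁ h.unit : ℂˣ) : ℂ) else 0) (e : LocalRing L v) ∂ν) *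
        -((ν.real {d : ↥(HeisRing.fixedPart (conjLocal L (IsCMField.complexConj L) v)) | Valued.v ((d : LocalRing L v) w) < 1} : ℝ) : ℂ) := by
    rw [← integral_mul_const]
    refine setIntegral_congr_fun ((hCm.inter hT1m).diff hT0m) fun e he => ?_
    show (fun r : LocalRing L v => if h : IsUnit r then ((χ₁ h.unit : ℂˣ) : ℂ) else 0) (e : LocalRing L v) * I e = (fun r : LocalRing L v => if h : IsUnit r then ((χ₁ h.unit : ℂˣ) : ℂ) else 0) (e : LocalRing L v) * -((ν.real {d : ↥(HeisRing.fixedPart (conjLocal L (IsCMField.complexConj L) v)) | Valued.v ((d : LocalRing L v) w) < 1} : ℝ) : ℂ)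
    rw [hIdef]; beta_reduce
    have h := hI₁ _ (hfix e) he.1.1 he.1.2 he.2
    beta_reduce at h
    rw [h]
  -- piece `C ∖ T_{2(d−1)}`: `I = 0`
  have h2 : ∫ e in C \ T1, (fun r : LocalRing L v => if h : IsUnit r then ((χ₁ h.unit : ℂˣ) : ℂ) else 0) (e : LocalRing L v) * I e ∂ν = 0 := by
    refine setIntegral_eq_zero_of_forall_eq_zero fun e he => ?_
    show (fun r : LocalRing L v => if h : IsUnit r then ((χ₁ h.unit : ℂˣ) : ℂ) else 0) (e : LocalRing L v) * I e = 0
    rw [hIdef]; beta_reduce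
    have h := hI₂ _ (hfix e) he.1 he.2
    beta_reduce at h
    rw [h, mul_zero]
  rw [h0, h1, h2, setIntegral_fixedUnits_inter_deepThreshold_dite_eq L v w hw ν χ₁ hB hD,
    setIntegral_fixedUnits_middleSlice_dite_eq L v w hw ν χ₁ h₁ hB hFε hD]
  ring

end Haar

end Summit.HodgeConjecture.HodgeConjecture.R90.S1.WildGaussSquareModLetters

end
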